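/- Copyright: the b2b-balaban cell (near-miss cell 7), T⁴-continuum fan-out, ROUND-2 swarm `t4-ne7b-formalise-*`
(leaf 08), row NE7b (node U5c COUNT member; twins of lineage t4-ne7b-p3's tagged-label timing for the print-exact
carriers).  Released under the licence of the surrounding project. -/
import Summits.QuantumFields.BalabanUV.T4Continuum.Support.HistoryRealisePrintTimed
import Summits.QuantumFields.BalabanUV.T4Continuum.Support.SpaceTimeTagged

/-!
# Print-exactly realised histories: `Gen.WF` and the tagged label's timing RE-DERIVED for `RealisesP` ∕ `PendingBefore`
(row S1b-P2 «print-exact carriers», part 4 — the two `SpaceTime*` destructuring sites of R-OWNER-40-2; repair R-40-a)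

Summits-side support leaf of the T⁴-continuum cell (rung (B)+1 on a FINITE torus only; NOT infinite volume, NOT the
mass gap, NOT the Clay statement; NOT a proof of the spine estimate NE7b, which is the cell's OWN estimate, NOT PRINTED
and NOT PROVED).  Row S1b-P2 (R-OWNER-40-2, `CLAIMS.log` l.26158; claim l.26451), custodian lineage leaf-08; parts 1–3 =
`HistoryRealisePrintTimed` (p246807), `HistoryRealisePrintReading` (p246985), `HistoryRealisePrintCells`.

WHY.  The owner's ruling lists, among the six sites that DESTRUCTURE the join clause's partner pendency `hpX`∕`hpY`,
lineage t4-ne7b-p3's `SpaceTimeRealisedLE.wf_toGen_of_realises` (l.101) and `SpaceTimeTagged.wf_toGenT_of_realises`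
(l.203) — the M∕T roads' «`Gen.WF` of the (tagged) canonical label FROM THE GEOMETRY», each using row S1b's
`lt_reach_of_pendingAt` on the partners and `renew_lt_reach`∕`adm_of_realises`.  THIS FILE re-derives them, and the two
by-name siblings `consistentTLE_toGenT_of_realises` ∕ `lt_reach_toGenT_of_pendingAt`, for the PRINT-EXACT predicate:
proofs token for token with the core's `lt_reach_of_pendingBefore` ∕ `renew_lt_reach_P` ∕ `adm_of_realisesP` and part
1's `consistentTLE_toGen_of_realisesP`; SAME conclusions.  Imports only part 1 and `SpaceTimeTagged` (the tagged label
`toGenT`, `tag_range`): `wf_toGen_of_realisesP` needs nothing of `SpaceTimeRealisedLE`'s heavier cone.  Append-only; the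
M∕T-road readings over `Realises ∧ PendingAt ∧ TypeNodup` (`lineageReadingsLE`, `runReadingsFlowLE_typed`, …) are left
to their custodians (row S12-P analogue), each a by-name re-plug over these four lemmas.

WHAT.  §1 **`wf_toGen_of_realisesP`** (`P.TypeNodup → RealisesP L s R P Z → P.toGen.WF (dictW R n₁)`).  §2
`consistentTLE_toGenT_of_realisesP`, `lt_reach_toGenT_of_pendingBefore`, **`wf_toGenT_of_realisesP`** (for EVERY
print-exactly realised history, no `TypeNodup`).  [folklore] junction lemmas; nothing printed asserted, no
`def … : Prop`, no `[cite:]`, zero `sorry`.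

HONEST.  Junction lemmas on OUR carriers; H3-type readings, (B) and the BetaPertH-flow facts stay DISPLAYED; by-name
class of every `WALL-NE7b-P1.md` §2 binder UNCHANGED; NE7b NOT proved; spine 0∕9.  HONEST DEPENDENCY (cell): continuum YM
on T⁴ ⇐ BetaPertH ∧ nine spine estimates (0/9 proved); BetaPertH ⇐ (D1) ∧ (D4) ∧ CAP+tail; G-an2-4 gates asym, D1 and
NE2/3/4.  This file changes none of it. -/

open Finset

namespace Summit.QuantumFields.BalabanUV.T4Continuum.SpaceTimePeierls

open Literature.MathematicalPhysics.QuantumFieldTheory.Balaban1983to89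
open Literature.MathematicalPhysics.QuantumFieldTheory.Balaban1983to89.B13ScaleTransfer
open Literature.MathematicalPhysics.QuantumFieldTheory.Balaban1983to89.B16SProfile
open T4PersistenceDictionary T4TaggedShapeBanking
open Summit.QuantumFields.BalabanUV.T4Continuum.ZoneSkeleton (gmap events_gmap reach_gmap rootStep_gmap)
open Summit.QuantumFields.BalabanUV.T4Continuum.HistoryAdmissible
open Summit.QuantumFields.BalabanUV.T4Continuum.HistoryRealise
open Summit.QuantumFields.BalabanUV.T4Continuum.HistoryRealisePrint
open Summit.QuantumFields.BalabanUV.T4Continuum.HistoryBankingLE (ConsistentTLE)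
open Summit.QuantumFields.BalabanUV.T4Continuum.LateMergers (FreshT)

noncomputable section

/-! ## §1 A print-exactly realised history with distinct event types has a well-formed canonical label -/

section WF

variable {d L : ℕ} {s R : ℕ → ℕ} (hL : 4 ≤ L) (hdrop : ∀ m, DropCtl s m) (hR : ∀ t, 1 ≤ R t) {n₁ : ℕ}
  (hn₁ : 13 ≤ n₁)
include hL hdrop hR hn₁

/-- **`Gen.WF` OF THE CANONICAL LABEL FROM THE PRINT-EXACT GEOMETRY**: distinct event types give the distinctness
clauses (`distinct_toGen_iff`); a renewal happens after the root birth (`adm_of_realisesP`) and strictly inside the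
booked life (`renew_lt_reach_P`); a join happens inside both partners' booked lives (`lt_reach_of_pendingBefore` —
STRICT pendency at the join scale suffices) after their root births.  No `RenewAtReach`. [folklore] -/
theorem wf_toGen_of_realisesP :
    ∀ {P : PGen (Pt d × Finset (Pt d))} {Z : Finset (Pt d)}, P.TypeNodup → RealisesP L s R P Z →
      P.toGen.WF (dictW R n₁)
  | .birth _ _ _, _, _, _ => trivial
  | .renew G h, Z, hT, hRZ => by
      have hD := (PGen.distinct_toGen_iff (PGen.renew G h)).2 hT
      simp only [PGen.toGen, PGen.DistinctEv] at hD
      have hT' : ((h + 1, 1, 0) : PEv) ∉ G.evTypes ∧ G.TypeNodup := by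
        simpa [PGen.TypeNodup, PGen.evTypes, Multiset.nodup_cons] using hT
      have hlt : h < G.toGen.reach (dictW R n₁) := renew_lt_reach_P hL hdrop hR hn₁ hRZ
      obtain ⟨ZG, hG, hready, -, -⟩ := hRZ
      have hroot : G.rootStep ≤ G.lastStep := PGen.Adm.rootStep_le_lastStep (adm_of_realisesP G ZG hG le_rfl)
      have hpos := hready.pos
      simp only [PGen.toGen, Gen.WF, PGen.rootStep_toGen]
      exact ⟨wf_toGen_of_realisesP hT'.2 hG, hD.2, by omega, hlt⟩
  | .join X Y sj, Z, hT, hRZ => by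
      have hD := (PGen.distinct_toGen_iff (PGen.join X Y sj)).2 hT
      simp only [PGen.toGen, PGen.DistinctEv] at hD
      have hT' : (((sj, 2, 0) : PEv) ∉ X.evTypes ∧ ((sj, 2, 0) : PEv) ∉ Y.evTypes) ∧ X.TypeNodup ∧ Y.TypeNodup ∧
          Disjoint X.evTypes Y.evTypes := by
        simpa [PGen.TypeNodup, PGen.evTypes, Multiset.nodup_cons, Multiset.nodup_add] using hT
      obtain ⟨-, hTX, hTY, -⟩ := hT'
      obtain ⟨ZX, ZY, hX, hY, htX, htY, hpX, hpY, -, -⟩ := hRZ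
      have hrX : sj < X.toGen.reach (dictW R n₁) := lt_reach_of_pendingBefore hL hdrop hR hn₁ hX hpX
      have hrY : sj < Y.toGen.reach (dictW R n₁) := lt_reach_of_pendingBefore hL hdrop hR hn₁ hY hpY
      have hxr : X.rootStep ≤ X.lastStep := PGen.Adm.rootStep_le_lastStep (adm_of_realisesP X ZX hX le_rfl)
      have hyr : Y.rootStep ≤ Y.lastStep := PGen.Adm.rootStep_le_lastStep (adm_of_realisesP Y ZY hY le_rfl)
      simp only [PGen.toGen, Gen.WF, PGen.rootStep_toGen]
      exact ⟨wf_toGen_of_realisesP hTX hX, wf_toGen_of_realisesP hTY hY, hD.2.2.1, hD.2.2.2.1, hD.2.2.2.2,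
        by omega, by omega⟩

end WF

/-! ## §2 Timing of the tagged label from the print-exact geometry -/

section Timing

variable {d L : ℕ} {s R : ℕ → ℕ} (hL : 4 ≤ L) (hdrop : ∀ m, DropCtl s m) (hR : ∀ t, 1 ≤ R t)
include hL hdrop hR

/-- **THE TAGGED LABEL OF A PRINT-EXACTLY REALISED HISTORY IS `ConsistentTLE Prod.snd`** (cutoff `K ≥ lastStep`): part 1's
flat statement transported along `gmap Prod.snd (toGenT n P) = P.toGen`. [folklore] -/
theorem consistentTLE_toGenT_of_realisesP (C : T4PrintedShapeBanking.Consts) (hn₁ : 13 ≤ C.n₁)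
    {P : PGen (Pt d × Finset (Pt d))} {Z : Finset (Pt d)} (hP : RealisesP L s R P Z) {K : ℕ} (hK : P.lastStep ≤ K)
    (n : ℕ) : ConsistentTLE Prod.snd C K R (toGenT n P) := by
  rw [← consistentTLE_gmap_iff, gmap_snd_toGenT]
  exact consistentTLE_toGen_of_realisesP hL hdrop hR C hn₁ P Z hP hK

variable {n₁ : ℕ} (hn₁ : 13 ≤ n₁)
include hn₁

/-- **PENDING STRICTLY BEFORE THE CUTOFF ⇒ INSIDE THE BOOKED LIFE, tagged form**:
`K < (toGenT n P).reach (dictWT Prod.snd R n₁)`. [folklore] -/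
theorem lt_reach_toGenT_of_pendingBefore {P : PGen (Pt d × Finset (Pt d))} {Z : Finset (Pt d)}
    (hP : RealisesP L s R P Z) {K : ℕ} (hK : PendingBefore L s R P.lastStep Z K) (n : ℕ) :
    K < (toGenT n P).reach (dictWT Prod.snd R n₁) := by
  rw [dictWT_eq_comp, reach_toGenT]
  exact lt_reach_of_pendingBefore hL hdrop hR hn₁ hP hK

/-- **`Gen.WF` OF THE TAGGED LABEL FROM THE PRINT-EXACT GEOMETRY** — for EVERY print-exactly realised history (no
`TypeNodup`): distinctness from the tags (`tag_range`); a renewal after the root birth (`adm_of_realisesP`) and strictly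
inside the booked life (`renew_lt_reach_P`); a join inside both partners' booked lives (`lt_reach_of_pendingBefore`)
after their root births. [folklore] -/
theorem wf_toGenT_of_realisesP :
    ∀ {P : PGen (Pt d × Finset (Pt d))} {Z : Finset (Pt d)}, RealisesP L s R P Z →
      ∀ n : ℕ, (toGenT n P).WF (dictWT Prod.snd R n₁)
  | .birth _ _ _, _, _, _ => trivial
  | .renew G h, Z, hRZ, n => by
      have hlt : h < G.toGen.reach (dictW R n₁) := renew_lt_reach_P hL hdrop hR hn₁ hRZ
      obtain ⟨ZG, hG, hready, -, -⟩ := hRZ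
      have hroot : G.rootStep ≤ G.lastStep := PGen.Adm.rootStep_le_lastStep (adm_of_realisesP G ZG hG le_rfl)
      have hpos := hready.pos
      have hnot : (n, ((h + 1, 1, 0) : PEv)) ∉ (toGenT (n + 1) G).events := fun hmem => by
        have := tag_range (n + 1) G _ hmem
        simp at this
      simp only [toGenT, Gen.WF]
      refine ⟨wf_toGenT_of_realisesP hG (n + 1), hnot, ?_, ?_⟩
      · rw [rootStep_toGenT]; omega
      · rw [dictWT_eq_comp, reach_toGenT]; exact hlt
  | .join X Y sj, Z, hRZ, n => by
      obtain ⟨ZX, ZY, hX, hY, htX, htY, hpX, hpY, -, -⟩ := hRZ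
      have hrX : sj < X.toGen.reach (dictW R n₁) := lt_reach_of_pendingBefore hL hdrop hR hn₁ hX hpX
      have hrY : sj < Y.toGen.reach (dictW R n₁) := lt_reach_of_pendingBefore hL hdrop hR hn₁ hY hpY
      have hxr : X.rootStep ≤ X.lastStep := PGen.Adm.rootStep_le_lastStep (adm_of_realisesP X ZX hX le_rfl)
      have hyr : Y.rootStep ≤ Y.lastStep := PGen.Adm.rootStep_le_lastStep (adm_of_realisesP Y ZY hY le_rfl)
      have hnotX : (n, ((sj, 2, 0) : PEv)) ∉ (toGenT (n + 1) X).events := fun hmem => by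
        have := tag_range (n + 1) X _ hmem
        simp at this
      have hnotY : (n, ((sj, 2, 0) : PEv)) ∉ (toGenT (n + 1 + evCount X) Y).events := fun hmem => by
        have := tag_range (n + 1 + evCount X) Y _ hmem
        simp only at this
        omega
      have hdis : Disjoint (toGenT (n + 1) X).events (toGenT (n + 1 + evCount X) Y).events := by
        rw [Finset.disjoint_left]
        intro e heX heY
        have h1 := tag_range (n + 1) X e heX
        have h2 := tag_range (n + 1 + evCount X) Y e heY
        omega
      simp only [toGenT, Gen.WF]
      refine ⟨wf_toGenT_of_realisesP hX (n + 1), wf_toGenT_of_realisesP hY (n + 1 + evCount X), hnotX, hnotY, hdis,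
        ?_, ?_⟩
      · rw [rootStep_toGenT, dictWT_eq_comp, reach_toGenT]; omega
      · rw [rootStep_toGenT, dictWT_eq_comp, reach_toGenT]; omega

end Timing

end

end Summit.QuantumFields.BalabanUV.T4Continuum.SpaceTimePeierls
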